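import Summits.MatrixMultiplication.OmegaCensus.STPP122RankThreeCertCoverA

/-!
# (1,2,2)³ in (ℤ/3)³ — the RANK-3 ROOM CERTIFICATE, covering decisions B (`decide +kernel`, chunks `b = 14 … 26`)

Cell `pub-omega` (unit `pub-omega-stpp-1-g34`), topic `Summits/MatrixMultiplication/OmegaCensus`.
HONEST FRAMING (verbatim): lottery ticket; floor = certified bounds/negative ranges. Kernel decisions of `Rank3Cert.coverB g3 b` (engine and
meaning: `STPP122RankThreeCertEngine.lean`); nothing here is a bound on `ω`.
-/

namespace Summit.MatrixMultiplication.OmegaCensus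

namespace Rank3Cert

open STPP211Neg

set_option maxRecDepth 20000
set_option maxHeartbeats 1000000

/-- Covering, chunk `b = 14` (kernel). -/
theorem cover_14 : coverB g3 14 = true := by
  decide +kernel

/-- Covering, chunk `b = 15` (kernel). -/
theorem cover_15 : coverB g3 15 = true := by
  decide +kernel

/-- Covering, chunk `b = 16` (kernel). -/
theorem cover_16 : coverB g3 16 = true := by
  decide +kernel

/-- Covering, chunk `b = 17` (kernel). -/
theorem cover_17 : coverB g3 17 = true := by
  decide +kernel

/-- Covering, chunk `b = 18` (kernel). -/
theorem cover_18 : coverB g3 18 = true := by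
  decide +kernel

/-- Covering, chunk `b = 19` (kernel). -/
theorem cover_19 : coverB g3 19 = true := by
  decide +kernel

/-- Covering, chunk `b = 20` (kernel). -/
theorem cover_20 : coverB g3 20 = true := by
  decide +kernel

/-- Covering, chunk `b = 21` (kernel). -/
theorem cover_21 : coverB g3 21 = true := by
  decide +kernel

/-- Covering, chunk `b = 22` (kernel). -/
theorem cover_22 : coverB g3 22 = true := by
  decide +kernel

/-- Covering, chunk `b = 23` (kernel). -/
theorem cover_23 : coverB g3 23 = true := by
  decide +kernel

/-- Covering, chunk `b = 24` (kernel). -/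
theorem cover_24 : coverB g3 24 = true := by
  decide +kernel

/-- Covering, chunk `b = 25` (kernel). -/
theorem cover_25 : coverB g3 25 = true := by
  decide +kernel

/-- Covering, chunk `b = 26` (kernel). -/
theorem cover_26 : coverB g3 26 = true := by
  decide +kernel

/-- **COVERING:** every block 1 passing the two-block tests is a word-image of a representative. -/
theorem cover_all : coverOK g3 = true := by
  have h : ∀ b ∈ codes, coverB g3 b = true := by
    intro b hb
    simp only [codes, List.mem_range] at hb
    interval_cases b
    exacts [cover_0, cover_1, cover_2, cover_3, cover_4, cover_5, cover_6, cover_7, cover_8, cover_9, cover_10, cover_11, cover_12,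
      cover_13, cover_14, cover_15, cover_16, cover_17, cover_18, cover_19, cover_20, cover_21, cover_22, cover_23, cover_24, cover_25, cover_26]
  exact List.all_eq_true.2 h

end Rank3Cert

end Summit.MatrixMultiplication.OmegaCensus
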